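import Literature.Computability.AlgebraicComplexity.MoreAsymmetricStructure
import Literature.Computability.AlgebraicComplexity.GlobalStageHoles
import HarnessLib

/-!
# The `Y`- and `Z`-holes of the copies of `𝒯*` in the more asymmetric global stage: Claim 5.20,
Markov's inequality and the existence of a good seed
(Alman–Duan–Vassilevska Williams–Xu–Xu–Zhou 2025, §5.5) — proved

Topic `Literature/Computability/AlgebraicComplexity`.  §5.5 of Alman–Duan–Vassilevska Williams–Xu–Xu–
Zhou, *More asymmetry yields faster matrix multiplication* (SODA 2025, arXiv:2404.16349) bounds the
holes of the broken copies `𝒯_ZUseful|_{X_I Y_J Z_K}` of `𝒯*` (`MoreAsymmetricStructure.lean`: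
`MoreAsym.holesY ω T`, `MoreAsym.holesZ ω T` — the level-1 `Y`-blocks, resp. `Z`-blocks, useful for the
triple `T` of `𝒯_hash` but compatible with another triple of `𝒯_hash` through `Y_J`, resp. `Z_K`):

> **Claim 5.20 (Essentially [VXXZ24]).** For every `b ∈ B`, every level-`ℓ` block triple
> `X_I Y_J Z_K` consistent with `α`, and every typical `Z_K̂ ∈ Z_K`, the probability that `Z_K̂` is
> compatible with multiple triples in `𝒯_ZComp` is at most `numalpha · p_compZ / (numzblock · M₀)`,
> conditioned on `h_X(I) = h_Y(J) = h_Z(K) = b`.  Similarly … every typical `Y_Ĵ ∈ Y_J` … is compatible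
> with multiple triples in `𝒯_YComp` [with probability] at most `numalpha · p_compY / (numyblock · M₀)`.
> … By Markov's inequality, this fraction exceeds `1/8N` with probability `≤ 1/10`.  The same applies
> to the fraction of holes of `Y`-variables.  Therefore, by union bound, with constant probability, the
> level-`ℓ` block `X_I Y_J Z_K` remains and `𝒯_ZUseful|_{X_I Y_J Z_K}` is a broken copy of `𝒯*` whose
> fraction of holes is `≤ 1/8N` in all three dimensions.  The expected number of such `X_I Y_J Z_K` is
> `numalpha · M^{-1-o(1)}`.

This file PROVES these statements as exact counts over the seed space `Ω = VxxzSeed M n`, for the data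
`D : GlobalStageData c n M` of one region (well-formed, `B` without 3-term progressions, `M` an odd
prime `> 2c`), exactly as `GlobalStageHoles.lean` does for VXXZ's `Z`-holes:

* `holePairsY` — the pairs `(Ĵ, T')` behind the `Y`-holes of the copy over `T` (`Ĵ ∈ Y_J` useful for
  `T`, `T' ∈ 𝒯α ∖ {T}` through `Y_J`, `Y`-compatible with `Ĵ`); the `Z`-pairs are `holePairs` of
  `GlobalStageHoles.lean`; `U_Y(T) = |holePairsY T|`, `U_Z(T) = |holePairs T|`;
* `MoreAsym.holeY_subset`, `MoreAsym.holeZ_subset` — a hole witnesses such a pair with `T'` in the SAME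
  bucket as `T` (both triples are in `𝒯_hash`, hence each in one bucket, and they share `Y_J`, resp. `Z_K`);
* `MoreAsym.sum_card_holesY_le`, `MoreAsym.sum_card_holesZ_le` — **Claim 5.20 summed** ("linearity of
  expectation"): over the seeds putting `T` into bucket `b`, `∑_ω |holesY_ω T| ≤ U_Y(T) · M^{n−1}` and
  `∑_ω |holesZ_ω T| ≤ U_Z(T) · M^{n−1}` (each pair contributes the `M^{n−1}` seeds putting `T` and `T'`
  into bucket `b`, Lemma 5.5 (1): triples sharing `Y_J`, resp. `Z_K`);
* `MoreAsym.card_seeds_manyHolesY/Z_mul_succ_le` — **Markov** (threshold `h + 1`);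
* `MoreAsym.card_seeds_good_ge` — with Lemma 5.5 (2) (`advxxz2025_lemma55_survival`, `7/8`): if
  `8|𝒯| ≤ M |typeClass μX|`, `10 U_Y(T) M^{n−1} ≤ (h_Y+1) M^n` and `10 U_Z(T) M^{n−1} ≤ (h_Z+1) M^n` (the
  second and third terms of `M₀`, eq. (M₀ final), with `h_W = ⌊M_W/8N⌋`), then at least HALF of the `M^n`
  seeds putting `T ∈ 𝒯α` into `b ∈ B` make `T` a triple of `𝒯_hash` with at most `h_Y` `Y`-holes and at
  most `h_Z` `Z`-holes (`7/8 − 1/10 − 1/10 ≥ 1/2`; the paper's "constant probability");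
* `MoreAsym.exists_seed_many_good_copies` — summing over `B × 𝒯α` and averaging: **some seed `ω` makes at
  least `|B| · |𝒯α| / (2M²)` triples of `𝒯_hash` good** — the "`numalpha · M^{-1-o(1)}` independent broken
  copies of `𝒯*` with `≤ 1/8N` fraction of holes" of §5.5, in exact form.

Everything is proved; one definition (`holePairsY`); no named facts.

## References

* J. Alman, R. Duan, V. Vassilevska Williams, Y. Xu, Z. Xu, R. Zhou, *More asymmetry yields faster
  matrix multiplication*, SODA 2025, arXiv:2404.16349 (held: `paper:arxiv-2404.16349`, chunk p0020):
  Claim 5.20, eq. (M₀ final), the Markov/union-bound paragraph of §5.5, Lemma 5.5.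
  [AlmanDuanVassilevskaWilliamsXuXuZhou2025]
* V. Vassilevska Williams, Y. Xu, Z. Xu, R. Zhou, *New bounds for matrix multiplication: from alpha
  to omega*, SODA 2024, arXiv:2307.07970, Claim 5.16 and §5.6 (the original, `Z`-holes only).
  [VassilevskaWilliamsXuXuZhou2024]
-/

noncomputable section

open scoped BigOperators
open Finset

namespace Literature.Computability.AlgebraicComplexity

namespace GlobalStageData

open scoped Classical

variable {c n M : ℕ} (D : GlobalStageData c n M)

/-- **The pairs `(Ĵ, T')` behind the `Y`-holes of the copy over `T`**: `Ĵ ∈ Y_J` useful for `T`, and a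
triple `T' ∈ 𝒯α` other than `T` through the same `Y_J` with which `Ĵ` is `Y`-compatible.  Their number
`U_Y(T)` is the printed `∑_{Ĵ} (numalpha/numyblock) · p_compY`. [cite: AlmanDuanVassilevskaWilliamsXuXuZhou2025, Claim 5.20 (second part)] -/
def holePairsY (T : (Fin n → Fin (2 * c + 1)) × (Fin n → Fin (2 * c + 1)) × (Fin n → Fin (2 * c + 1))) :
    Finset ((Fin n → Fin c → Fin 3) × ((Fin n → Fin (2 * c + 1)) × (Fin n → Fin (2 * c + 1)) × (Fin n → Fin (2 * c + 1)))) :=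
  (univ ×ˢ D.𝒯α).filter fun p => blockOfSeq p.1 = T.2.1 ∧ D.UsefulY T p.1 ∧ p.2 ≠ T ∧ p.2.2.1 = T.2.1 ∧
    D.YCompatible p.2 p.1

namespace MoreAsym

variable {D} [Fact M.Prime]

/-- **A `Y`-hole witnesses a `Y`-compatible triple in the same bucket**: if `Ĵ` is a `Y`-hole of the copy
over the triple `T` of `𝒯_hash` (seed `ω`), then some `T' ∈ 𝒯α`, `T' ≠ T`, through `Y_J`, `Y`-compatible
with `Ĵ`, lies in the bucket `h_X(I)` of `T` (triples of `𝒯_hash` are hash-present, hence in one bucket,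
and the two share `Y_J`). [cite: AlmanDuanVassilevskaWilliamsXuXuZhou2025, Claim 5.20 (second part)] -/
theorem holeY_subset (hM : M ≠ 2) (hB : ThreeAPFree (D.B : Set (ZMod M))) {ω : VxxzSeed M n}
    {T : (Fin n → Fin (2 * c + 1)) × (Fin n → Fin (2 * c + 1)) × (Fin n → Fin (2 * c + 1))}
    (hT : T ∈ D.hashTriples ω) {Jh : Fin n → Fin c → Fin 3} (hJ : Jh ∈ holesY D ω T) :
    ∃ T', (Jh, T') ∈ D.holePairsY T ∧ InBucket (2 * c) ω T' (vxxzHashX ω (seqVal T.1)) := by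
  rw [holesY, mem_filter] at hJ
  obtain ⟨-, hblk, hu, T', hT'p, hne, hJ', hc⟩ := hJ
  refine ⟨T', mem_filter.2 ⟨mem_product.2 ⟨mem_univ _, xPresentTriples_subset hT'p⟩, hblk, hu, hne, hJ', hc⟩, ?_⟩
  have hTb := inBucket_of_mem_hashPresent hM hB (hashPresent_of_mem_xPresentTriples hT)
  have hT'b := inBucket_of_mem_hashPresent hM hB (hashPresent_of_mem_xPresentTriples hT'p)
  have e : vxxzHashX ω (seqVal T'.1) = vxxzHashX ω (seqVal T.1) := by
    rw [← hT'b.2.1, ← hTb.2.1, hJ']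
  rwa [e] at hT'b

/-- **A `Z`-hole witnesses a compatible triple in the same bucket** (as `GlobalStageData.hole_subset`, for
the triples of `𝒯_hash`). [cite: AlmanDuanVassilevskaWilliamsXuXuZhou2025, Claim 5.20 (first part)] -/
theorem holeZ_subset (hM : M ≠ 2) (hB : ThreeAPFree (D.B : Set (ZMod M))) {ω : VxxzSeed M n}
    {T : (Fin n → Fin (2 * c + 1)) × (Fin n → Fin (2 * c + 1)) × (Fin n → Fin (2 * c + 1))}
    (hT : T ∈ D.hashTriples ω) {Kh : Fin n → Fin c → Fin 3} (hK : Kh ∈ holesZ D ω T) :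
    ∃ T', (Kh, T') ∈ D.holePairs T ∧ InBucket (2 * c) ω T' (vxxzHashX ω (seqVal T.1)) := by
  rw [holesZ, mem_filter] at hK
  obtain ⟨-, hblk, hu, T', hT'p, hne, hK', hc⟩ := hK
  refine ⟨T', mem_filter.2 ⟨mem_product.2 ⟨mem_univ _, xPresentTriples_subset hT'p⟩, hblk, hu, hne, hK', hc⟩, ?_⟩
  have hTb := inBucket_of_mem_hashPresent hM hB (hashPresent_of_mem_xPresentTriples hT)
  have hT'b := inBucket_of_mem_hashPresent hM hB (hashPresent_of_mem_xPresentTriples hT'p)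
  have e : vxxzHashX ω (seqVal T'.1) = vxxzHashX ω (seqVal T.1) := by
    rw [← hT'b.2.2, ← hTb.2.2, hK']
  rwa [e] at hT'b

/-- **Claim 5.20 (second part), summed over the useful `Y`-blocks and the seeds of the bucket**: over the
seeds putting `T ∈ 𝒯α` into bucket `b` (with `T ∈ 𝒯_hash`), `∑_ω |holesY_ω T| ≤ U_Y(T) · M^{n−1}` — each
pair `(Ĵ, T')` contributes the `M^{n−1}` seeds putting both `T` and `T'` into bucket `b` (Lemma 5.5 (1),
triples sharing `Y_J`). [cite: AlmanDuanVassilevskaWilliamsXuXuZhou2025, Claim 5.20 and Lemma 5.5 (1)] -/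
theorem sum_card_holesY_le (hD : D.WellFormed) (hM : M ≠ 2) (hcM : 2 * c < M) (hn : 0 < n)
    (hB : ThreeAPFree (D.B : Set (ZMod M)))
    {T : (Fin n → Fin (2 * c + 1)) × (Fin n → Fin (2 * c + 1)) × (Fin n → Fin (2 * c + 1))}
    (hT : T ∈ D.𝒯α) (b : ZMod M) :
    ∑ ω ∈ univ.filter (fun ω : VxxzSeed M n => InBucket (2 * c) ω T b ∧ T ∈ D.hashTriples ω), (holesY D ω T).card ≤
      (D.holePairsY T).card * M ^ (n - 1) := by
  have hT𝒯 : T ∈ D.tripleSet := hD.subset hT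
  have step1 : ∀ ω : VxxzSeed M n, InBucket (2 * c) ω T b → T ∈ D.hashTriples ω →
      (holesY D ω T).card ≤ ((D.holePairsY T).filter fun p => InBucket (2 * c) ω T b ∧ InBucket (2 * c) ω p.2 b).card := by
    intro ω hb hp
    refine Finset.card_le_card_of_surjOn Prod.fst fun Jh hJh => ?_
    obtain ⟨T', hp', hb'⟩ := holeY_subset hM hB hp (mem_coe.1 hJh)
    refine ⟨(Jh, T'), mem_coe.2 (mem_filter.2 ⟨hp', hb, ?_⟩), rfl⟩
    rwa [hb.1] at hb'
  calc ∑ ω ∈ univ.filter (fun ω : VxxzSeed M n => InBucket (2 * c) ω T b ∧ T ∈ D.hashTriples ω), (holesY D ω T).card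
      ≤ ∑ ω ∈ univ.filter (fun ω : VxxzSeed M n => InBucket (2 * c) ω T b ∧ T ∈ D.hashTriples ω),
          ((D.holePairsY T).filter fun p => InBucket (2 * c) ω T b ∧ InBucket (2 * c) ω p.2 b).card :=
        sum_le_sum fun ω hω => step1 ω (mem_filter.1 hω).2.1 (mem_filter.1 hω).2.2
    _ ≤ ∑ ω : VxxzSeed M n, ((D.holePairsY T).filter fun p => InBucket (2 * c) ω T b ∧ InBucket (2 * c) ω p.2 b).card :=
        sum_le_sum_of_subset_of_nonneg (filter_subset _ _) fun _ _ _ => Nat.zero_le _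
    _ = ∑ p ∈ D.holePairsY T, (univ.filter fun ω : VxxzSeed M n => InBucket (2 * c) ω T b ∧ InBucket (2 * c) ω p.2 b).card := by
        simp only [card_filter]
        rw [sum_comm]
    _ = ∑ _p ∈ D.holePairsY T, M ^ (n - 1) := by
        refine sum_congr rfl fun p hp => ?_
        obtain ⟨hp𝒯, -, -, hne, h2, -⟩ := mem_filter.1 hp
        exact card_seeds_inBucket_shareY hM hcM hn hT𝒯 (hD.subset (mem_product.1 hp𝒯).2) hne h2 b
    _ = (D.holePairsY T).card * M ^ (n - 1) := by rw [sum_const, smul_eq_mul]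

/-- **Claim 5.20 (first part), summed**: `∑_ω |holesZ_ω T| ≤ U_Z(T) · M^{n−1}` over the seeds putting
`T ∈ 𝒯α` into bucket `b` with `T ∈ 𝒯_hash`. [cite: AlmanDuanVassilevskaWilliamsXuXuZhou2025, Claim 5.20 and Lemma 5.5 (1)] -/
theorem sum_card_holesZ_le (hD : D.WellFormed) (hM : M ≠ 2) (hcM : 2 * c < M) (hn : 0 < n)
    (hB : ThreeAPFree (D.B : Set (ZMod M)))
    {T : (Fin n → Fin (2 * c + 1)) × (Fin n → Fin (2 * c + 1)) × (Fin n → Fin (2 * c + 1))}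
    (hT : T ∈ D.𝒯α) (b : ZMod M) :
    ∑ ω ∈ univ.filter (fun ω : VxxzSeed M n => InBucket (2 * c) ω T b ∧ T ∈ D.hashTriples ω), (holesZ D ω T).card ≤
      (D.holePairs T).card * M ^ (n - 1) := by
  have hT𝒯 : T ∈ D.tripleSet := hD.subset hT
  have step1 : ∀ ω : VxxzSeed M n, InBucket (2 * c) ω T b → T ∈ D.hashTriples ω →
      (holesZ D ω T).card ≤ ((D.holePairs T).filter fun p => InBucket (2 * c) ω T b ∧ InBucket (2 * c) ω p.2 b).card := by
    intro ω hb hp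
    refine Finset.card_le_card_of_surjOn Prod.fst fun Kh hKh => ?_
    obtain ⟨T', hp', hb'⟩ := holeZ_subset hM hB hp (mem_coe.1 hKh)
    refine ⟨(Kh, T'), mem_coe.2 (mem_filter.2 ⟨hp', hb, ?_⟩), rfl⟩
    rwa [hb.1] at hb'
  calc ∑ ω ∈ univ.filter (fun ω : VxxzSeed M n => InBucket (2 * c) ω T b ∧ T ∈ D.hashTriples ω), (holesZ D ω T).card
      ≤ ∑ ω ∈ univ.filter (fun ω : VxxzSeed M n => InBucket (2 * c) ω T b ∧ T ∈ D.hashTriples ω),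
          ((D.holePairs T).filter fun p => InBucket (2 * c) ω T b ∧ InBucket (2 * c) ω p.2 b).card :=
        sum_le_sum fun ω hω => step1 ω (mem_filter.1 hω).2.1 (mem_filter.1 hω).2.2
    _ ≤ ∑ ω : VxxzSeed M n, ((D.holePairs T).filter fun p => InBucket (2 * c) ω T b ∧ InBucket (2 * c) ω p.2 b).card :=
        sum_le_sum_of_subset_of_nonneg (filter_subset _ _) fun _ _ _ => Nat.zero_le _
    _ = ∑ p ∈ D.holePairs T, (univ.filter fun ω : VxxzSeed M n => InBucket (2 * c) ω T b ∧ InBucket (2 * c) ω p.2 b).card := by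
        simp only [card_filter]
        rw [sum_comm]
    _ = ∑ _p ∈ D.holePairs T, M ^ (n - 1) := by
        refine sum_congr rfl fun p hp => ?_
        obtain ⟨hp𝒯, -, -, hne, h3, -⟩ := mem_filter.1 hp
        exact card_seeds_inBucket_shareZ hM hcM hn hT𝒯 (hD.subset (mem_product.1 hp𝒯).2) hne h3 b
    _ = (D.holePairs T).card * M ^ (n - 1) := by rw [sum_const, smul_eq_mul]

/-- **Markov's inequality for the `Y`-holes** (threshold `h+1`): at most `U_Y(T) M^{n−1}/(h+1)` seeds of
the bucket give more than `h` `Y`-holes. [cite: AlmanDuanVassilevskaWilliamsXuXuZhou2025, §5.5 ("By Markov's inequality, this fraction exceeds 1/8N with probability ≤ 1/10")] -/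
theorem card_seeds_manyHolesY_mul_succ_le (hD : D.WellFormed) (hM : M ≠ 2) (hcM : 2 * c < M) (hn : 0 < n)
    (hB : ThreeAPFree (D.B : Set (ZMod M)))
    {T : (Fin n → Fin (2 * c + 1)) × (Fin n → Fin (2 * c + 1)) × (Fin n → Fin (2 * c + 1))}
    (hT : T ∈ D.𝒯α) (b : ZMod M) (h : ℕ) :
    (univ.filter fun ω : VxxzSeed M n =>
        InBucket (2 * c) ω T b ∧ T ∈ D.hashTriples ω ∧ h < (holesY D ω T).card).card * (h + 1) ≤
      (D.holePairsY T).card * M ^ (n - 1) := by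
  calc (univ.filter fun ω : VxxzSeed M n =>
          InBucket (2 * c) ω T b ∧ T ∈ D.hashTriples ω ∧ h < (holesY D ω T).card).card * (h + 1)
      = ∑ _ω ∈ univ.filter (fun ω : VxxzSeed M n =>
          InBucket (2 * c) ω T b ∧ T ∈ D.hashTriples ω ∧ h < (holesY D ω T).card), (h + 1) := by
        rw [sum_const, smul_eq_mul]
    _ ≤ ∑ ω ∈ univ.filter (fun ω : VxxzSeed M n =>
          InBucket (2 * c) ω T b ∧ T ∈ D.hashTriples ω ∧ h < (holesY D ω T).card), (holesY D ω T).card :=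
        sum_le_sum fun ω hω => Nat.succ_le_of_lt (mem_filter.1 hω).2.2.2
    _ ≤ ∑ ω ∈ univ.filter (fun ω : VxxzSeed M n => InBucket (2 * c) ω T b ∧ T ∈ D.hashTriples ω), (holesY D ω T).card := by
        refine sum_le_sum_of_subset_of_nonneg (fun ω hω => ?_) fun _ _ _ => Nat.zero_le _
        have h' := mem_filter.1 hω
        exact mem_filter.2 ⟨h'.1, h'.2.1, h'.2.2.1⟩
    _ ≤ (D.holePairsY T).card * M ^ (n - 1) := sum_card_holesY_le hD hM hcM hn hB hT b

/-- **Markov's inequality for the `Z`-holes** (threshold `h+1`). [cite: AlmanDuanVassilevskaWilliamsXuXuZhou2025, §5.5] -/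
theorem card_seeds_manyHolesZ_mul_succ_le (hD : D.WellFormed) (hM : M ≠ 2) (hcM : 2 * c < M) (hn : 0 < n)
    (hB : ThreeAPFree (D.B : Set (ZMod M)))
    {T : (Fin n → Fin (2 * c + 1)) × (Fin n → Fin (2 * c + 1)) × (Fin n → Fin (2 * c + 1))}
    (hT : T ∈ D.𝒯α) (b : ZMod M) (h : ℕ) :
    (univ.filter fun ω : VxxzSeed M n =>
        InBucket (2 * c) ω T b ∧ T ∈ D.hashTriples ω ∧ h < (holesZ D ω T).card).card * (h + 1) ≤
      (D.holePairs T).card * M ^ (n - 1) := by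
  calc (univ.filter fun ω : VxxzSeed M n =>
          InBucket (2 * c) ω T b ∧ T ∈ D.hashTriples ω ∧ h < (holesZ D ω T).card).card * (h + 1)
      = ∑ _ω ∈ univ.filter (fun ω : VxxzSeed M n =>
          InBucket (2 * c) ω T b ∧ T ∈ D.hashTriples ω ∧ h < (holesZ D ω T).card), (h + 1) := by
        rw [sum_const, smul_eq_mul]
    _ ≤ ∑ ω ∈ univ.filter (fun ω : VxxzSeed M n =>
          InBucket (2 * c) ω T b ∧ T ∈ D.hashTriples ω ∧ h < (holesZ D ω T).card), (holesZ D ω T).card :=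
        sum_le_sum fun ω hω => Nat.succ_le_of_lt (mem_filter.1 hω).2.2.2
    _ ≤ ∑ ω ∈ univ.filter (fun ω : VxxzSeed M n => InBucket (2 * c) ω T b ∧ T ∈ D.hashTriples ω), (holesZ D ω T).card := by
        refine sum_le_sum_of_subset_of_nonneg (fun ω hω => ?_) fun _ _ _ => Nat.zero_le _
        have h' := mem_filter.1 hω
        exact mem_filter.2 ⟨h'.1, h'.2.1, h'.2.2.1⟩
    _ ≤ (D.holePairs T).card * M ^ (n - 1) := sum_card_holesZ_le hD hM hcM hn hB hT b

/-- **The good seeds of a bucket** (Lemma 5.5 (2) + two Markov bounds + union bound, §5.5: "with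
constant probability, the level-`ℓ` block `X_I Y_J Z_K` remains and `𝒯_ZUseful|_{X_I Y_J Z_K}` is a broken
copy of `𝒯*` whose fraction of holes is `≤ 1/8N` in all three dimensions"): under the cleanup requirement
`8|𝒯| ≤ M |typeClass μX|` and the final constraints `10 U_Y(T) M^{n−1} ≤ (h_Y+1) M^n`,
`10 U_Z(T) M^{n−1} ≤ (h_Z+1) M^n` (the printed `M₀ ≥ (numalpha p_compW/numwblock) · 80N`, `W = Y, Z`,
with `h_W = ⌊M_W/8N⌋`), at least half of the `M^n` seeds putting `T ∈ 𝒯α` into `b ∈ B` make `T` a triple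
of `𝒯_hash` with at most `h_Y` `Y`-holes and at most `h_Z` `Z`-holes (`7/8 − 1/10 − 1/10 ≥ 1/2`).
[cite: AlmanDuanVassilevskaWilliamsXuXuZhou2025, §5.5 (eq. (M₀ final) and the union-bound paragraph)] -/
theorem card_seeds_good_ge (hD : D.WellFormed) (hM : M ≠ 2) (hcM : 2 * c < M) (hn : 0 < n)
    (hB : ThreeAPFree (D.B : Set (ZMod M)))
    (h8X : 8 * D.tripleSet.card ≤ M * (typeClass n D.μX).card)
    {T : (Fin n → Fin (2 * c + 1)) × (Fin n → Fin (2 * c + 1)) × (Fin n → Fin (2 * c + 1))}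
    (hT : T ∈ D.𝒯α) {b : ZMod M} (hb : b ∈ D.B) {hY hZ : ℕ}
    (hUY : 10 * ((D.holePairsY T).card * M ^ (n - 1)) ≤ (hY + 1) * M ^ n)
    (hUZ : 10 * ((D.holePairs T).card * M ^ (n - 1)) ≤ (hZ + 1) * M ^ n) :
    M ^ n ≤ 2 * (univ.filter fun ω : VxxzSeed M n =>
      T ∈ D.hashTriples ω ∧ InBucket (2 * c) ω T b ∧ (holesY D ω T).card ≤ hY ∧ (holesZ D ω T).card ≤ hZ).card := by
  have hT𝒯 : T ∈ D.tripleSet := hD.subset hT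
  -- Lemma 5.5 (2): the `X`-survivors
  have h55 := advxxz2025_lemma55_survival hM hcM hn h8X hT𝒯 b
  set Sv := univ.filter fun ω : VxxzSeed M n => XSurvives D.tripleSet ω T b with hSv
  set good := univ.filter fun ω : VxxzSeed M n =>
    T ∈ D.hashTriples ω ∧ InBucket (2 * c) ω T b ∧ (holesY D ω T).card ≤ hY ∧ (holesZ D ω T).card ≤ hZ with hgood
  set badY := univ.filter fun ω : VxxzSeed M n =>
    InBucket (2 * c) ω T b ∧ T ∈ D.hashTriples ω ∧ hY < (holesY D ω T).card with hbadY
  set badZ := univ.filter fun ω : VxxzSeed M n =>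
    InBucket (2 * c) ω T b ∧ T ∈ D.hashTriples ω ∧ hZ < (holesZ D ω T).card with hbadZ
  -- survivors are in `𝒯_hash` (the bucket is in `B`) and either good or bad
  have hcover : Sv ⊆ good ∪ (badY ∪ badZ) := by
    intro ω hω
    rw [hSv, mem_filter] at hω
    have hpres : T ∈ D.hashTriples ω := by
      rw [hashTriples, xPresentTriples_eq_filter_xSurvives hM hD.subset ω hB, mem_filter]
      exact ⟨hT, b, hb, hω.2⟩
    have hin : InBucket (2 * c) ω T b := hω.2.1
    rw [mem_union, mem_union, hgood, hbadY, hbadZ, mem_filter, mem_filter, mem_filter]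
    by_cases hleY : (holesY D ω T).card ≤ hY
    · by_cases hleZ : (holesZ D ω T).card ≤ hZ
      · exact Or.inl ⟨mem_univ _, hpres, hin, hleY, hleZ⟩
      · exact Or.inr (Or.inr ⟨mem_univ _, hin, hpres, Nat.lt_of_not_le hleZ⟩)
    · exact Or.inr (Or.inl ⟨mem_univ _, hin, hpres, Nat.lt_of_not_le hleY⟩)
  have hSv_le : Sv.card ≤ good.card + (badY.card + badZ.card) :=
    (card_le_card hcover).trans ((card_union_le _ _).trans (Nat.add_le_add_left (card_union_le _ _) _))
  -- Markov: `10 |badY| ≤ M^n`, `10 |badZ| ≤ M^n`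
  have hbadY_le : 10 * badY.card ≤ M ^ n := by
    have hm := card_seeds_manyHolesY_mul_succ_le hD hM hcM hn hB hT b hY
    have : 10 * badY.card * (hY + 1) ≤ (hY + 1) * M ^ n := by
      calc 10 * badY.card * (hY + 1) = 10 * (badY.card * (hY + 1)) := by ring
        _ ≤ 10 * ((D.holePairsY T).card * M ^ (n - 1)) := Nat.mul_le_mul_left _ hm
        _ ≤ (hY + 1) * M ^ n := hUY
    rw [mul_comm (hY + 1)] at this
    exact Nat.le_of_mul_le_mul_right this (Nat.succ_pos hY)
  have hbadZ_le : 10 * badZ.card ≤ M ^ n := by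
    have hm := card_seeds_manyHolesZ_mul_succ_le hD hM hcM hn hB hT b hZ
    have : 10 * badZ.card * (hZ + 1) ≤ (hZ + 1) * M ^ n := by
      calc 10 * badZ.card * (hZ + 1) = 10 * (badZ.card * (hZ + 1)) := by ring
        _ ≤ 10 * ((D.holePairs T).card * M ^ (n - 1)) := Nat.mul_le_mul_left _ hm
        _ ≤ (hZ + 1) * M ^ n := hUZ
    rw [mul_comm (hZ + 1)] at this
    exact Nat.le_of_mul_le_mul_right this (Nat.succ_pos hZ)
  omega

/-- For a fixed seed, the good pairs `(b, T)`, `b ∈ B`, are counted by the good triples (the bucket of a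
triple of `𝒯_hash` is `h_X(I) ∈ B`). [cite: AlmanDuanVassilevskaWilliamsXuXuZhou2025, §5.2 (buckets)] -/
theorem card_filter_product_good_eq (hM : M ≠ 2) (hB : ThreeAPFree (D.B : Set (ZMod M)))
    (hsub : D.𝒯α ⊆ D.tripleSet) (ω : VxxzSeed M n) (hY hZ : ℕ) :
    ((D.B ×ˢ D.𝒯α).filter fun bT => bT.2 ∈ D.hashTriples ω ∧ InBucket (2 * c) ω bT.2 bT.1 ∧
        (holesY D ω bT.2).card ≤ hY ∧ (holesZ D ω bT.2).card ≤ hZ).card =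
      ((D.hashTriples ω).filter fun T => (holesY D ω T).card ≤ hY ∧ (holesZ D ω T).card ≤ hZ).card := by
  refine card_bij (fun bT _ => bT.2) (fun bT hbT => ?_) (fun bT₁ h₁ bT₂ h₂ heq => ?_) (fun T hT => ?_)
  · rw [mem_filter] at hbT
    exact mem_filter.2 ⟨hbT.2.1, hbT.2.2.2⟩
  · rw [mem_filter] at h₁ h₂
    have e : bT₁.1 = bT₂.1 := by
      have e1 := h₁.2.2.1.1
      have e2 := h₂.2.2.1.1
      rw [heq] at e1
      exact e1.symm.trans e2
    exact Prod.ext e heq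
  · rw [mem_filter] at hT
    obtain ⟨hTp, hle⟩ := hT
    have hTα : T ∈ D.𝒯α := xPresentTriples_subset hTp
    have hsurv : ∃ b ∈ D.B, XSurvives D.tripleSet ω T b := by
      have := hTp
      rw [hashTriples, xPresentTriples_eq_filter_xSurvives hM hsub ω hB, mem_filter] at this
      exact this.2
    obtain ⟨b, hb, hs⟩ := hsurv
    exact ⟨(b, T), mem_filter.2 ⟨mem_product.2 ⟨hb, hTα⟩, hTp, hs.1, hle⟩, rfl⟩

/-- **Existence of a good seed** (§5.5: "in expectation, we obtain `numalpha · M^{-1-o(1)}` independent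
broken copies of `𝒯*` with `≤ 1/8N` fraction of holes", in exact form): under the hypotheses of
`card_seeds_good_ge` for every `T ∈ 𝒯α`, some seed `ω` makes at least `|B| · |𝒯α| / (2M²)` triples of
`𝒯_hash` good: `|B| |𝒯α| ≤ 2M² · #{T ∈ 𝒯_hash(ω) | |holesY_ω T| ≤ h_Y ∧ |holesZ_ω T| ≤ h_Z}`.
[cite: AlmanDuanVassilevskaWilliamsXuXuZhou2025, §5.5 (last paragraph) and §5.6] -/
theorem exists_seed_many_good_copies (hD : D.WellFormed) (hM : M ≠ 2) (hcM : 2 * c < M) (hn : 0 < n)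
    (hB : ThreeAPFree (D.B : Set (ZMod M)))
    (h8X : 8 * D.tripleSet.card ≤ M * (typeClass n D.μX).card) {hY hZ : ℕ}
    (hUY : ∀ T ∈ D.𝒯α, 10 * ((D.holePairsY T).card * M ^ (n - 1)) ≤ (hY + 1) * M ^ n)
    (hUZ : ∀ T ∈ D.𝒯α, 10 * ((D.holePairs T).card * M ^ (n - 1)) ≤ (hZ + 1) * M ^ n) :
    ∃ ω : VxxzSeed M n, D.B.card * D.𝒯α.card ≤
      2 * M ^ 2 * ((D.hashTriples ω).filter fun T => (holesY D ω T).card ≤ hY ∧ (holesZ D ω T).card ≤ hZ).card := by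
  have hsum : D.B.card * D.𝒯α.card * M ^ n ≤ 2 * ∑ ω : VxxzSeed M n,
      ((D.hashTriples ω).filter fun T => (holesY D ω T).card ≤ hY ∧ (holesZ D ω T).card ≤ hZ).card := by
    have hswap : ∑ ω : VxxzSeed M n, ((D.B ×ˢ D.𝒯α).filter fun bT =>
        bT.2 ∈ D.hashTriples ω ∧ InBucket (2 * c) ω bT.2 bT.1 ∧
          (holesY D ω bT.2).card ≤ hY ∧ (holesZ D ω bT.2).card ≤ hZ).card =
        ∑ bT ∈ D.B ×ˢ D.𝒯α, (univ.filter fun ω : VxxzSeed M n =>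
          bT.2 ∈ D.hashTriples ω ∧ InBucket (2 * c) ω bT.2 bT.1 ∧
            (holesY D ω bT.2).card ≤ hY ∧ (holesZ D ω bT.2).card ≤ hZ).card := by
      simp only [card_filter]
      rw [sum_comm]
    calc D.B.card * D.𝒯α.card * M ^ n = ∑ _bT ∈ D.B ×ˢ D.𝒯α, M ^ n := by
          rw [sum_const, card_product, smul_eq_mul]
      _ ≤ ∑ bT ∈ D.B ×ˢ D.𝒯α, 2 * (univ.filter fun ω : VxxzSeed M n =>
            bT.2 ∈ D.hashTriples ω ∧ InBucket (2 * c) ω bT.2 bT.1 ∧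
              (holesY D ω bT.2).card ≤ hY ∧ (holesZ D ω bT.2).card ≤ hZ).card :=
          sum_le_sum fun bT hbT => card_seeds_good_ge hD hM hcM hn hB h8X (mem_product.1 hbT).2
            (mem_product.1 hbT).1 (hUY _ (mem_product.1 hbT).2) (hUZ _ (mem_product.1 hbT).2)
      _ = 2 * ∑ ω : VxxzSeed M n, ((D.hashTriples ω).filter fun T =>
            (holesY D ω T).card ≤ hY ∧ (holesZ D ω T).card ≤ hZ).card := by
          rw [← mul_sum, ← hswap]
          congr 1
          exact sum_congr rfl fun ω _ => card_filter_product_good_eq hM hB hD.subset ω hY hZ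
  by_contra hcon
  simp only [not_exists, not_le] at hcon
  have hlt : ∑ ω : VxxzSeed M n, 2 * M ^ 2 * ((D.hashTriples ω).filter fun T =>
      (holesY D ω T).card ≤ hY ∧ (holesZ D ω T).card ≤ hZ).card <
      ∑ _ω : VxxzSeed M n, D.B.card * D.𝒯α.card :=
    sum_lt_sum_of_nonempty univ_nonempty fun ω _ => hcon ω
  rw [sum_const, card_univ, card_vxxzSeed, smul_eq_mul, ← mul_sum] at hlt
  have : M ^ (n + 2) * (D.B.card * D.𝒯α.card) ≤
      2 * M ^ 2 * ∑ ω : VxxzSeed M n, ((D.hashTriples ω).filter fun T =>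
        (holesY D ω T).card ≤ hY ∧ (holesZ D ω T).card ≤ hZ).card := by
    calc M ^ (n + 2) * (D.B.card * D.𝒯α.card) = M ^ 2 * (D.B.card * D.𝒯α.card * M ^ n) := by ring
      _ ≤ M ^ 2 * (2 * ∑ ω : VxxzSeed M n, ((D.hashTriples ω).filter fun T =>
          (holesY D ω T).card ≤ hY ∧ (holesZ D ω T).card ≤ hZ).card) := Nat.mul_le_mul_left _ hsum
      _ = _ := by ring
  exact absurd (lt_of_le_of_lt this hlt) (lt_irrefl _)

end MoreAsym

end GlobalStageData

end Literature.Computability.AlgebraicComplexity
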